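import Literature.AlgebraicGeometry.AbelianSchemes.RigidDescentAlongUnitSection
import Literature.AlgebraicGeometry.AbelianSchemes.AbelianSchemeDualTransport
import Literature.AlgebraicGeometry.AbelianSchemes.RigidifiedLineBundleComap
import Literature.AlgebraicGeometry.AbelianSchemes.RigidifyAlongUnitSlice
import Literature.AlgebraicGeometry.RelativeSpec.GeometricQuotientFreeBasePullback
import Literature.AlgebraicGeometry.RelativeSpec.GeometricQuotientFreeEquivariantDescent
import Literature.AlgebraicGeometry.RelativeSpec.EquivariantModuleRankDescent
import Literature.AlgebraicGeometry.Modules.EquivariantStructureRestrictOfPullback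
import Literature.AlgebraicGeometry.Modules.RankOneDescentAlongH0Iso
import HarnessLib

/-!
# The Poincaré sheaf descends along a free finite quotient OF THE BASE
# ([MFK94] Ch. 7 §3 remark after Thm. 7.9, Lemma 7.11; [Mumford AV] §8 pp. 78–80, §12 Thm. 1; SGA 1 VIII 1.1/7.8)

Topic `AlgebraicGeometry/AbelianSchemes`; namespace `Literature.AlgebraicGeometry.AbelianSchemes.AbelianSchemeOver`.
THEOREMS ONLY (no definition, no named fact, no instance, no notation, no `sorry`; net Literature debt 0).
Cell hodgecm-mathlib (D-0151), F-DAG price sheet leaf F-10 (10a) «the universal triple DESCENDS along the free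
finite quotient of the base `M → M/Γ`», the DUAL-PAIR instalment, part 1: after ★ `AbelianSchemeBaseQuotientDescent`
(the abelian scheme `A` and — applied to `Â` — the dual abelian scheme descend to `B`, `B̂` over `Q`), the POINCARÉ
SHEAF `𝒫` on `A ×_S Â` descends to a rigidified line bundle `𝒫_B` on `B ×_Q B̂` with `(π ×_p π̂)^* 𝒫_B ≅ 𝒫`.
(Part 2, the sequel files: `𝒫_B` is fibrewise in `Pic⁰` and `(B̂, 𝒫_B)` has the universal property over `Q`, i.e.
is a ★ `DualPair` of `B`.)  HC_CM is proved only modulo the 7 printed citations until rung 0 closes; this file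
discharges none of them (count-neutral capital).

SETTING.  `p : S → Q` an AFFINE geometric quotient of `S` by a FREE action `ρ` of the finite group `G` (ring-form
freeness); `A` an abelian scheme over `S` with a dual pair `D = (Â, 𝒫)`, `Â` REDUCED and locally Noetherian (e.g. `S`
smooth over a field); `B`, `B̂` abelian schemes over `Q` and `π : A → B`, `π̂ : Â → B̂` exhibiting `A`, `Â` as the base
changes of `B`, `B̂` along `p` AS GROUP SCHEMES (★ `IsBaseChangeVia`; produced by ★ `AbelianSchemeBaseQuotientDescent`);
actions `ρA`, `ρÂ` of `G` on `A`, `Â` over `π`, `π̂` which COVER `ρ` by isomorphisms of group schemes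
(`hA : ∀ g, A.IsBaseChangeVia A (ρ g) (ρA g)`, `hÂ` likewise); and the POINCARÉ CLAUSE of these `G`-isomorphisms of
triples: for every `g`, `(ρA(g) ×_{ρ(g)} ρÂ(g))^* 𝒫 ≅ 𝒫` — stated with Mathlib's `pullback.map`, token for token the
Poincaré clause of ★ `PolarizedAbelianSchemeWithLevel.IsBaseChangeVia` (NO cocycle condition is asked: it comes for
free, §2).  Write `ϖ := π ×_p π̂ : A ×_S Â → B ×_Q B̂` (`pullback.map`).

* §0 (junction) (β)/(T1) ★ `ActionOver.exists_descent_of_free_of_hasRank` fed with a bundled ★ `EquivariantStructure`,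
  stated for a VARIABLE action so that the instantiation below is a syntactic match (private).
* §1 `isGeometricQuotient_onPullback_prodQuotientMap`, `free_onPullback_prodQuotientMap`,
  `autHom_comp_unitSection_baseChange_hat`, `unitSection_baseChange_hat_comp_prodQuotientMap` — the DIAGONAL action
  `ρA ×_ρ ρÂ` of `G` on `A ×_S Â` over `ϖ` (★ `ActionOver.onPullback`) makes `ϖ` a FREE affine geometric quotient (★
  `isGeometricQuotient_onPullback_map_of_free`, ★ `free_of_equivariant`); the unit section `ε_A × 1 : Â → A ×_S Â`
  is equivariant and `(ε_A × 1) ≫ ϖ = π̂ ≫ (ε_B × 1)`.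
* §2 `exists_equivariantStructure_poincare` — **the cocycle for free**: a `G`-linearisation `Φ` of `𝒫` for the
  diagonal action whose restriction along `ε_A × 1` is the TRIVIAL linearisation of `(ε_A × 1)^*𝒫 ≅ 𝒪_Â` EXISTS —
  Mumford's normalisation along `{0} × X` in families, ★ `exists_equivariantStructure_of_restrictAlong_unitSection`
  (this is where `Â` reduced is used: rigidified isomorphisms of line bundles on `A ×_S Â → Â` are unique).
* §3 `exists_poincare_desc_of_free_base_quotient` — `𝒫 ≅ ϖ^* 𝒫₀` for a quasi-coherent LINE BUNDLE `𝒫₀` on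
  `B ×_Q B̂` (★ (β) through §0).
* §4 **`exists_rigidified_poincare_desc_of_free_base_quotient`** — THE HEAD: there is a line bundle `𝒫_B` on
  `B ×_Q B̂`, RIGIDIFIED along `ε_B × 1_{B̂}` (`(ε_B × 1)^* 𝒫_B ≅ 𝒪_{B̂}`), with `ϖ^* 𝒫_B ≅ 𝒫`: `𝒫_B := rigidify 𝒫₀`
  (★ `RigidifyAlongUnitSlice`); the comparison survives the rigidification because the twist
  `pr^* (ε_B × 1)^* 𝒫₀` dies after `ϖ^*` (`ϖ ≫ pr ≫ (ε_B × 1) = pr ≫ (ε_A × 1) ≫ ϖ` and `𝒫` is rigidified, ★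
  `cechPic_pullback_unitSlice_detClass_eq_one`; determinant classes in ★ `CechPic`).

Mathlib searched (pin): `pullback.map`, `pullback.hom_ext`, `MorphismProperty.IsStableUnderBaseChange.of_isPullback`
(all used); Mathlib has no quotients of schemes by finite groups, no linearisations and no dual abelian schemes.

## References
* D. Mumford, J. Fogarty, F. Kirwan, *Geometric Invariant Theory*, 3rd ed. (1994), Ch. 1 §3 Def. 1.6 (p. 30);
  Ch. 6 §2 (p. 121); Ch. 7 §1 Prop. 7.1 (p. 127), §3 remark after Thm. 7.9 and Lemma 7.11 (pp. 139–140).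
  [MumfordFogartyKirwan1994]
* D. Mumford, *Abelian Varieties* (1970), §7 Thm. p. 66, §8 pp. 78–80, §12 Thm. 1 (p. 112), §13 (p. 125). [MumfordAV1970]
* A. Grothendieck, *SGA 1*, Exp. V §1, Prop. 2.6, Déf. 2.7; Exp. VIII Thm. 1.1, Prop. 1.10, Cor. 7.8. [SGA1]
* J. S. Milne, *Abelian Varieties* (v2.00, 2008), I §8 pp. 36–37. [MilneAV2008]
-/

noncomputable section

universe u

open CategoryTheory Limits AlgebraicGeometry MonoidalCategory CartesianMonoidalCategory MonObj

namespace Literature.AlgebraicGeometry.AbelianSchemes.AbelianSchemeOver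

open Literature.AlgebraicGeometry.RelativeSpec Literature.AlgebraicGeometry.RelativeSpec.ActionOver
  Literature.AlgebraicGeometry.Modules Literature.AlgebraicGeometry.Motives
  Literature.AlgebraicGeometry.AbelianVarieties

set_option backward.isDefEq.respectTransparency false

/-! ### §0 Junction: (β) fed with a bundled equivariant structure, for a VARIABLE action -/

section Aux

variable {X Y : Scheme.{u}} {r : X ⟶ Y} {G : Type u} [Group G] [Fintype G] [IsAffineHom r] (τ : ActionOver r G)
  (hτ : τ.IsGeometricQuotient r)
  (hfr : ∀ (V : Y.Opens), IsAffineOpen V → ∀ g : G, g ≠ 1 →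
    Ideal.span (Set.range fun b : Γ(X, r ⁻¹ᵁ V) ↦ τ.act g V b - b) = ⊤)
  (E : X.Modules)

include hτ hfr in
/-- (β)/(T1) for a bundled equivariant structure and a VARIABLE action `τ` (so that the instantiation at the diagonal
action of §1 is a syntactic match): a rank-`n` module with a `G`-linearisation on the total space of a free affine
geometric quotient `r : X → Y` is `r^* F` for a quasi-coherent `F` of rank `n`. [cite: MumfordAV1970, §12 Thm. 1 (p. 112)]
[cite: SGA1, Exp. VIII Prop. 1.10] -/
private theorem exists_descent_of_equivariantStructure (Ψ : τ.EquivariantStructure E) {n : ℕ} (hE : HasRank E n) :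
    ∃ (F : Y.Modules) (_ : F.IsQuasicoherent) (_ : HasRank F n), Nonempty ((Scheme.Modules.pullback r).obj F ≅ E) := by
  haveI := isQuasicoherent_of_hasRank hE
  obtain ⟨F, hF, hF1, e, -⟩ :=
    τ.exists_descent_of_free_of_hasRank E Ψ.iso hτ hfr Ψ.iso_one_hom Ψ.iso_mul_hom hE
  exact ⟨F, hF, hF1, ⟨e⟩⟩

end Aux

variable {S Q : Scheme.{u}} {p : S ⟶ Q} {G : Type u} [Group G] [Fintype G] {ρ : ActionOver p G}
  (hq : ρ.IsGeometricQuotient p) [IsAffineHom p]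
  (hfree : ∀ (V : Q.Opens), IsAffineOpen V → ∀ g : G, g ≠ 1 →
    Ideal.span (Set.range fun s : Γ(S, p ⁻¹ᵁ V) ↦ ρ.act g V s - s) = ⊤)
  (A : AbelianSchemeOver S) (D : A.DualPair)
  (B : AbelianSchemeOver Q) {π : A.X.left ⟶ B.X.left} (ρA : ActionOver π G) (hAB : A.IsBaseChangeVia B p π)
  (hA : ∀ g : G, A.IsBaseChangeVia A (ρ.aut g).hom (ρA.aut g).hom)
  (Bh : AbelianSchemeOver Q) {πh : D.hat.X.left ⟶ Bh.X.left} (ρh : ActionOver πh G)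
  (hABh : D.hat.IsBaseChangeVia Bh p πh)
  (hAh : ∀ g : G, D.hat.IsBaseChangeVia D.hat (ρ.aut g).hom (ρh.aut g).hom)

/-! ### §1 The diagonal action on `A ×_S Â` over `ϖ = π ×_p π̂ : A ×_S Â → B ×_Q B̂` -/

include hq hfree in
/-- **`ϖ = π ×_p π̂ : A ×_S Â → B ×_Q B̂` is a geometric quotient** for the diagonal action `ρA ×_ρ ρÂ` (★
`ActionOver.onPullback`; its `g`-th automorphism is Mathlib's `pullback.map _ _ _ _ (ρA g) (ρÂ g) (ρ g) _ _` BY `rfl`):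
`A ×_S Â = (B ×_Q B̂) ×_Q S` and every base change of the free affine quotient `p` is a geometric quotient (★
`isGeometricQuotient_onPullback_map_of_free`). [cite: SGA1, Exp. V §1 and Prop. 2.6, Déf. 2.7]
[cite: MumfordAV1970, §7 Thm. p. 66] -/
theorem isGeometricQuotient_onPullback_prodQuotientMap :
    (ActionOver.onPullback A.X.hom D.hat.X.hom ρA.aut ρh.aut ρ.aut (fun g => (hA g).fst) (fun g => (hAh g).fst)
        (pullback.map A.X.hom D.hat.X.hom B.X.hom Bh.X.hom π πh p hAB.fst.symm hABh.fst.symm)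
        (ActionOver.IsGeometricQuotient.pullbackMapHom_comp_map ρA (fun g => (hA g).fst) hAB.fst.symm ρh
          (fun g => (hAh g).fst) hABh.fst.symm)).IsGeometricQuotient
      (pullback.map A.X.hom D.hat.X.hom B.X.hom Bh.X.hom π πh p hAB.fst.symm hABh.fst.symm) :=
  hq.isGeometricQuotient_onPullback_map_of_free hfree hAB.snd.1.flip ρA _ hABh.snd.1.flip ρh _

include hfree in
omit [Fintype G] in
/-- **The diagonal action on `A ×_S Â` is free** (ring form on the affine charts of `ϖ`): `pr_A ≫ (A → S)` is
equivariant to the free `G`-scheme `S` (★ `free_of_equivariant`). [cite: SGA1, Exp. V Prop. 2.6 (i), Déf. 2.7] -/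
theorem free_onPullback_prodQuotientMap
    [IsAffineHom (pullback.map A.X.hom D.hat.X.hom B.X.hom Bh.X.hom π πh p hAB.fst.symm hABh.fst.symm)] :
    ∀ (V : (pullback B.X.hom Bh.X.hom).Opens), IsAffineOpen V → ∀ g : G, g ≠ 1 →
      Ideal.span (Set.range fun b : Γ(pullback A.X.hom D.hat.X.hom,
          pullback.map A.X.hom D.hat.X.hom B.X.hom Bh.X.hom π πh p hAB.fst.symm hABh.fst.symm ⁻¹ᵁ V) ↦
        (ActionOver.onPullback A.X.hom D.hat.X.hom ρA.aut ρh.aut ρ.aut (fun g => (hA g).fst) (fun g => (hAh g).fst)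
          (pullback.map A.X.hom D.hat.X.hom B.X.hom Bh.X.hom π πh p hAB.fst.symm hABh.fst.symm)
          (ActionOver.IsGeometricQuotient.pullbackMapHom_comp_map ρA (fun g => (hA g).fst) hAB.fst.symm ρh
            (fun g => (hAh g).fst) hABh.fst.symm)).act g V b - b) = ⊤ := by
  have heq : ∀ g : G,
      (ActionOver.pullbackMapHom A.X.hom D.hat.X.hom ρA.aut ρh.aut ρ.aut (fun g => (hA g).fst)
          (fun g => (hAh g).fst) g).hom ≫ (pullback.fst A.X.hom D.hat.X.hom ≫ A.X.hom) =
        (pullback.fst A.X.hom D.hat.X.hom ≫ A.X.hom) ≫ (ρ.aut g).hom := fun g => by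
    rw [← Category.assoc, ActionOver.pullbackMapHom_hom_fst, Category.assoc, (hA g).fst, Category.assoc]
  exact ActionOver.IsGeometricQuotient.free_of_equivariant (ρ := ρ) hfree _
    (pullback.fst A.X.hom D.hat.X.hom ≫ A.X.hom) heq

omit [Fintype G] [IsAffineHom p] in
/-- **The unit section `ε_A × 1 : Â → A ×_S Â` of `A ×_S Â → Â` is `G`-equivariant** (for `ρÂ` on `Â` and the
diagonal action on `A ×_S Â`): `ρA(g)` preserves the unit section (unit clause of `hA`) and covers `ρ(g)` as `ρÂ(g)`
does. [cite: SGA1, Exp. V §1] [cite: MumfordFogartyKirwan1994, Ch. 6 §2 (p. 121)] -/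
theorem autHom_comp_unitSection_baseChange_hat (g : G) :
    ρh.autHom g ≫ (A.baseChange D.hat.X.hom).unitSection =
      (A.baseChange D.hat.X.hom).unitSection ≫
        (ActionOver.onPullback A.X.hom D.hat.X.hom ρA.aut ρh.aut ρ.aut (fun g => (hA g).fst) (fun g => (hAh g).fst)
          (pullback.map A.X.hom D.hat.X.hom B.X.hom Bh.X.hom π πh p hAB.fst.symm hABh.fst.symm)
          (ActionOver.IsGeometricQuotient.pullbackMapHom_comp_map ρA (fun g => (hA g).fst) hAB.fst.symm ρh
            (fun g => (hAh g).fst) hABh.fst.symm)).autHom g := by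
  have hu : A.unitSection ≫ (ρA.aut g).hom = (ρ.aut g).hom ≫ A.unitSection := (hA g).snd.2.1
  have hw : (ρh.aut g).hom ≫ D.hat.X.hom = D.hat.X.hom ≫ (ρ.aut g).hom := (hAh g).fst
  rw [DualPair.unitSection_baseChange_hat_eq_unitSlice]
  apply pullback.hom_ext
  · simp only [Category.assoc, unitSlice_fst]
    erw [ActionOver.pullbackMapHom_hom_fst]
    rw [unitSlice_fst_assoc]
    change (ρh.aut g).hom ≫ D.hat.X.hom ≫ A.unitSection = D.hat.X.hom ≫ A.unitSection ≫ (ρA.aut g).hom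
    rw [reassoc_of% hw, hu]
  · simp only [Category.assoc, unitSlice_snd, Category.comp_id]
    erw [ActionOver.pullbackMapHom_hom_snd]
    rw [unitSlice_snd_assoc]

omit [Fintype G] [IsAffineHom p] in
/-- **`(ε_A × 1) ≫ ϖ = π̂ ≫ (ε_B × 1)`**: the unit sections of `A ×_S Â → Â` and `B ×_Q B̂ → B̂` correspond under
`ϖ` and `π̂` (unit clause of `hAB`: `ε_A ≫ π = p ≫ ε_B`). [cite: MumfordFogartyKirwan1994, Ch. 6 §2 (p. 121) and Ch. 7 §2 Definition 7.2 (p. 129)] -/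
theorem unitSection_baseChange_hat_comp_prodQuotientMap :
    (A.baseChange D.hat.X.hom).unitSection ≫
        pullback.map A.X.hom D.hat.X.hom B.X.hom Bh.X.hom π πh p hAB.fst.symm hABh.fst.symm =
      πh ≫ B.unitSlice Bh := by
  have hu : A.unitSection ≫ π = p ≫ B.unitSection := hAB.snd.2.1
  rw [DualPair.unitSection_baseChange_hat_eq_unitSlice]
  apply pullback.hom_ext
  · rw [Category.assoc, pullback.lift_fst, unitSlice_fst_assoc, Category.assoc, unitSlice_fst, hu,
      ← Category.assoc, ← Category.assoc, hABh.fst]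
  · rw [Category.assoc, pullback.lift_snd, unitSlice_snd_assoc, Category.assoc, unitSlice_snd, Category.comp_id]

/-! ### §2 The cocycle for free: the normalised `G`-linearisation of `𝒫` -/

omit [Fintype G] [IsAffineHom p] in
/-- **THE POINCARÉ SHEAF IS `G`-LINEARISED (normalised along `ε_A × 1`).**  If for every `g` SOME isomorphism
`(ρA(g) ×_{ρ(g)} ρÂ(g))^* 𝒫 ≅ 𝒫` exists (the Poincaré clause of the `G`-isomorphisms of triples) and `Â` is reduced and
locally Noetherian, then `𝒫` carries a `G`-equivariant structure `Φ` for the diagonal action — unit AND COCYCLE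
conditions included — whose restriction along the equivariant unit section `ε_A × 1 : Â → A ×_S Â` is the trivial
linearisation of `(ε_A × 1)^*𝒫 ≅ 𝒪_Â = π̂^* 𝒪_{B̂}`: Mumford's normalisation of a linearisation along `{0} × X`, in
families (★ `exists_equivariantStructure_of_restrictAlong_unitSection` for the abelian scheme `A ×_S Â → Â`).
[cite: MumfordAV1970, §8 (pp. 78–80)] [cite: MumfordFogartyKirwan1994, Ch. 1 §3 Definition 1.6 (p. 30)]
[cite: MilneAV2008, I §8 pp. 36–37] -/
theorem exists_equivariantStructure_poincare [IsReduced D.hat.X.left] [IsLocallyNoetherian D.hat.X.left]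
    (hP : ∀ g : G, Nonempty ((Scheme.Modules.pullback
      (pullback.map A.X.hom D.hat.X.hom A.X.hom D.hat.X.hom (ρA.aut g).hom (ρh.aut g).hom (ρ.aut g).hom
        (hA g).fst.symm (hAh g).fst.symm)).obj D.P ≅ D.P)) :
    ∃ Φ : (ActionOver.onPullback A.X.hom D.hat.X.hom ρA.aut ρh.aut ρ.aut (fun g => (hA g).fst) (fun g => (hAh g).fst)
        (pullback.map A.X.hom D.hat.X.hom B.X.hom Bh.X.hom π πh p hAB.fst.symm hABh.fst.symm)
        (ActionOver.IsGeometricQuotient.pullbackMapHom_comp_map ρA (fun g => (hA g).fst) hAB.fst.symm ρh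
          (fun g => (hAh g).fst) hABh.fst.symm)).EquivariantStructure D.P,
      ∀ g : G, restrictAlong
        (ActionOver.onPullback A.X.hom D.hat.X.hom ρA.aut ρh.aut ρ.aut (fun g => (hA g).fst) (fun g => (hAh g).fst)
          (pullback.map A.X.hom D.hat.X.hom B.X.hom Bh.X.hom π πh p hAB.fst.symm hABh.fst.symm)
          (ActionOver.IsGeometricQuotient.pullbackMapHom_comp_map ρA (fun g => (hA g).fst) hAB.fst.symm ρh
            (fun g => (hAh g).fst) hABh.fst.symm))
        ρh (A.baseChange D.hat.X.hom).unitSection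
        (autHom_comp_unitSection_baseChange_hat A D B ρA hAB hA Bh ρh hABh hAh) D.P g (Φ.iso g).hom =
        (((ActionOver.EquivariantStructure.ofPullback ρh (SheafOfModules.unit _)).ofIso
          (RigidifiedLineBundle.pullbackUnitIso πh ≪≫ (DualPair.selfBundle D).rigid.some.symm)).iso g).hom :=
  (A.baseChange D.hat.X.hom).exists_equivariantStructure_of_restrictAlong_unitSection _ ρh
    (autHom_comp_unitSection_baseChange_hat A D B ρA hAB hA Bh ρh hABh hAh) (DualPair.selfBundle D).hasRank_one hP _

/-! ### §3 Descent of `𝒫` to a line bundle on `B ×_Q B̂` -/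

include hq hfree in
/-- **THE POINCARÉ SHEAF DESCENDS TO `B ×_Q B̂`**: in the SETTING of the module docstring there is a quasi-coherent
LINE BUNDLE `𝒫₀` on `B ×_Q B̂` with `ϖ^* 𝒫₀ ≅ 𝒫`, `ϖ = π ×_p π̂` (Galois descent ★ (β)/(T1) along the free affine
geometric quotient `ϖ` of §1 for the normalised linearisation of §2).  [cite: MumfordAV1970, §12 Thm. 1 (p. 112)]
[cite: SGA1, Exp. VIII Thm. 1.1 and Prop. 1.10] [cite: MumfordFogartyKirwan1994, Ch. 7 §1 Prop. 7.1 (p. 127)] -/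
theorem exists_poincare_desc_of_free_base_quotient [IsReduced D.hat.X.left] [IsLocallyNoetherian D.hat.X.left]
    (hP : ∀ g : G, Nonempty ((Scheme.Modules.pullback
      (pullback.map A.X.hom D.hat.X.hom A.X.hom D.hat.X.hom (ρA.aut g).hom (ρh.aut g).hom (ρ.aut g).hom
        (hA g).fst.symm (hAh g).fst.symm)).obj D.P ≅ D.P)) :
    ∃ (P₀ : (B.prodLeft Bh).Modules) (_ : P₀.IsQuasicoherent) (_ : HasRank P₀ 1),
      Nonempty ((Scheme.Modules.pullback
        (pullback.map A.X.hom D.hat.X.hom B.X.hom Bh.X.hom π πh p hAB.fst.symm hABh.fst.symm)).obj P₀ ≅ D.P) := by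
  obtain ⟨Φ, -⟩ := exists_equivariantStructure_poincare A D B ρA hAB hA Bh ρh hABh hAh hP
  haveI : IsAffineHom (pullback.map A.X.hom D.hat.X.hom B.X.hom Bh.X.hom π πh p hAB.fst.symm hABh.fst.symm) :=
    MorphismProperty.IsStableUnderBaseChange.of_isPullback
      (isPullback_fst_comp_map hAB.snd.1.flip hABh.snd.1.flip) inferInstance
  exact exists_descent_of_equivariantStructure _
    (isGeometricQuotient_onPullback_prodQuotientMap hq hfree A D B ρA hAB hA Bh ρh hABh hAh)
    (free_onPullback_prodQuotientMap hfree A D B ρA hAB hA Bh ρh hABh hAh) D.P Φ D.hasRank_one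

/-! ### §4 The rigidified descended Poincaré sheaf `𝒫_B` -/

include hq hfree in
/-- **THE RIGIDIFIED DESCENDED POINCARÉ SHEAF.**  In the SETTING of the module docstring (free finite quotient
`p : S → Q = S/G` of the base; `A`, `Â` descending to `B`, `B̂` as group schemes; `G` acting on `A`, `Â` over the
quotient maps, covering `ρ` by isomorphisms of group schemes; the Poincaré clause `(ρA(g) ×_{ρ(g)} ρÂ(g))^*𝒫 ≅ 𝒫` for
all `g`; `Â` reduced and locally Noetherian) there is a LINE BUNDLE `𝒫_B` on `B ×_Q B̂` which is RIGIDIFIED along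
`ε_B × 1_{B̂}` — `(ε_B × 1)^* 𝒫_B ≅ 𝒪_{B̂}`, clause (b) of ★ `DualPair` — and satisfies `(π ×_p π̂)^* 𝒫_B ≅ 𝒫` — the
Poincaré clause of ★ `PolarizedAbelianSchemeWithLevel.IsBaseChangeVia` along `(π, π̂, p)`.  (`𝒫_B := rigidify 𝒫₀` for
the `𝒫₀` of §3, ★ `RigidifyAlongUnitSlice`; the comparison survives because `𝒫` is rigidified: the twist pulls back
along `ϖ` to `pr^* (ε_A × 1)^* 𝒫 ≅ 𝒪`.)  This is the sheaf half of «the dual pair descends along `M → M/Γ`» in the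
level-lowering step `A_{g,δ,N} = A_{g,δ,NK}/Γ`. [cite: MumfordFogartyKirwan1994, Ch. 7 §3, remark after Thm. 7.9 and Lemma 7.11 (pp. 139–140)]
[cite: MumfordFogartyKirwan1994, Ch. 6 §2 (p. 121)] [cite: MumfordAV1970, §12 Thm. 1 (p. 112) and §13 (p. 125)]
[cite: SGA1, Exp. VIII Cor. 7.8] -/
theorem exists_rigidified_poincare_desc_of_free_base_quotient [IsReduced D.hat.X.left]
    [IsLocallyNoetherian D.hat.X.left]
    (hP : ∀ g : G, Nonempty ((Scheme.Modules.pullback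
      (pullback.map A.X.hom D.hat.X.hom A.X.hom D.hat.X.hom (ρA.aut g).hom (ρh.aut g).hom (ρ.aut g).hom
        (hA g).fst.symm (hAh g).fst.symm)).obj D.P ≅ D.P)) :
    ∃ PB : (B.prodLeft Bh).Modules, HasRank PB 1 ∧
      Nonempty ((Scheme.Modules.pullback (B.unitSlice Bh)).obj PB ≅ SheafOfModules.unit _) ∧
      Nonempty ((Scheme.Modules.pullback
        (pullback.map A.X.hom D.hat.X.hom B.X.hom Bh.X.hom π πh p hAB.fst.symm hABh.fst.symm)).obj PB ≅ D.P) := by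
  obtain ⟨P₀, _, h₀, ⟨e⟩⟩ := exists_poincare_desc_of_free_base_quotient hq hfree A D B ρA hAB hA Bh ρh hABh hAh hP
  refine ⟨B.rigidify Bh P₀, hasRank_rigidify h₀, nonempty_pullback_unitSlice_rigidify_iso h₀, ?_⟩
  -- the comparison survives the rigidification: a determinant-class computation
  have hP₁ := HasRank.isFiniteLocallyFree' h₀
  have hR := hasRank_rigidify (A := B) (B := Bh) h₀
  have hR₁ := HasRank.isFiniteLocallyFree' hR
  have hD₁ := HasRank.isFiniteLocallyFree' D.hasRank_one
  -- `ϖ^*[𝒫₀] = [𝒫]`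
  have h1 : CechPic.pullback (pullback.map A.X.hom D.hat.X.hom B.X.hom Bh.X.hom π πh p hAB.fst.symm hABh.fst.symm)
      (detClass hP₁) = detClass hD₁ :=
    (detClass_pullback
      (f := pullback.map A.X.hom D.hat.X.hom B.X.hom Bh.X.hom π πh p hAB.fst.symm hABh.fst.symm)
      (hE := hP₁)).symm.trans (detClass_eq_of_iso e _ _)
  -- `ϖ ≫ pr ≫ (ε_B × 1) = pr ≫ (ε_A × 1) ≫ ϖ`
  have hcomp : pullback.map A.X.hom D.hat.X.hom B.X.hom Bh.X.hom π πh p hAB.fst.symm hABh.fst.symm ≫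
      pullback.snd B.X.hom Bh.X.hom ≫ B.unitSlice Bh =
      pullback.snd A.X.hom D.hat.X.hom ≫ A.unitSlice D.hat ≫
        pullback.map A.X.hom D.hat.X.hom B.X.hom Bh.X.hom π πh p hAB.fst.symm hABh.fst.symm := by
    rw [pullback.lift_snd_assoc, Category.assoc, ← unitSection_baseChange_hat_comp_prodQuotientMap A D B hAB Bh hABh,
      DualPair.unitSection_baseChange_hat_eq_unitSlice]
  -- the twist dies after `ϖ^*`
  have h2 : CechPic.pullback (pullback.map A.X.hom D.hat.X.hom B.X.hom Bh.X.hom π πh p hAB.fst.symm hABh.fst.symm)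
      (CechPic.pullback (pullback.snd B.X.hom Bh.X.hom) (CechPic.pullback (B.unitSlice Bh) (detClass hP₁))) = 1 := by
    rw [← CechPic.pullback_comp, ← CechPic.pullback_comp, Category.assoc, hcomp, CechPic.pullback_comp,
      CechPic.pullback_comp, h1, cechPic_pullback_unitSlice_detClass_eq_one (DualPair.selfBundle D) hD₁, map_one]
  refine (nonempty_iso_iff_detClass_eq (hasRank_pullback _ hR) D.hasRank_one (hR₁.pullback _) hD₁).2 ?_
  erw [detClass_pullback (hE := hR₁), detClass_rigidify h₀ hR₁, map_mul, map_inv, h1, h2, inv_one, _root_.mul_one]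

end Literature.AlgebraicGeometry.AbelianSchemes.AbelianSchemeOver

end
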